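import Summits.AtomisticToContinuum.HydrodynamicLimit.Theorems.BoxDissipativeWeakStrongFluxClosureEqHomPressureLemmas
import Summits.AtomisticToContinuum.HydrodynamicLimit.Theorems.BoxDissipativeWeakStrongFluxClosureOfParts
import Summits.AtomisticToContinuum.HydrodynamicLimit.Theorems.BoxDissipativeWeakStrongFluxClosureCollisionalVirialTight
import Summits.AtomisticToContinuum.HydrodynamicLimit.Theorems.BoxDissipativeWeakStrongLocalGibbsFineScaleStaticsMain
import HarnessLib

/-!
# Crux `FluxClosure` (stmt-AtomisticToContinuum-9902, route BoxDissipativeWeakStrong), line `registered`: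
# rung-0 piece E5 — the cut-pressure term in global equilibrium (registered stub `homogeneous_pressureTerm`)

Support file (`--supports stmt-AtomisticToContinuum-9902`) of the continuation lead's RUNG-0 PROGRAMME
(constant profiles `a₀ ≡ a`, `u₀ ≡ u`, `θ₀ ≡ θ`, law `P_N = localGibbsLaw σ a u θ N (Φ N)`). Registered stub
`homogeneous_pressureTerm`: GIVEN uniform-in-time fine-scale bounds
`∫⁻ z ∫⁻ₓ |ρ̂ − c₀| ≤ δ_N`, `∫⁻ z ∫⁻ₓ ‖m̂ − c₀u‖ ≤ δ_N`, `∫⁻ z ∫⁻ₓ |Ê − E(c₀,u,θ)| ≤ δ_N`, `δ_N → 0`, with `c₀ > 0`,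
`σ ≥ 0`, `η₁ ≥ 0` and `Z = hsCompressibility` continuous on `[0, η₁]`, the time-integrated CUT-PRESSURE TERM of the
box momentum balance, `∫_0^τ∫ p_cut(ρ̂, θ̂) div w` (`θ̂ = ⅔(Ê/ρ̂ − |m̂|²/2ρ̂²)`, `p_cut = ρ̂θ̂ Z(min(ρ̂σ³, η₁))`),
converges in `L¹(P_N)` to its constant-field value `∫_0^τ∫ c₀ θ Z(min(c₀σ³, η₁)) div w`.

Proof. Write `q = ρ̂θ̂ = ⅔Ê − |m̂|²/(3ρ̂)`, `q∞ = c₀θ`; then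
`p_cut − p∞ = (q − q∞) Z(min(ρ̂σ³,η₁)) + q∞ (Z(min(ρ̂σ³,η₁)) − Z(min(c₀σ³,η₁)))`, and the POINTWISE LEMMA of the
lemmas file (`E5_abs_cutPressure_sub_le`: Cauchy–Schwarz `|m̂|² ≤ 2ρ̂Ê`, `|Z| ≤ Z_max` on `[0, η₁]`, continuity of
`r ↦ Z(min(rσ³,η₁))` at `c₀`) gives `|p_cut − p∞| ≤ L (|ρ̂ − c₀| + ‖m̂ − c₀u‖ + |Ê − E₀|) + |c₀θ| κ` for every `κ > 0`.
Plumbing (`E5_orbit_bound`, `E5_lintegral_defect_le`): `P_N`-a.e. datum is good; along a good orbit both functionals are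
integrable in `t` and `x` (bounded measurable, `FluxClosureB4/B5`), `|div w| ≤ 3C_w`,
`ofReal |∫∫(F_N − F∞)| ≤ ∫⁻ₜ∫⁻ₓ ofReal |F_N − F∞|`, Tonelli in `(z, t)` (joint measurability of the flow on the good
set), the three hypotheses, and `P_N(univ) ≤ 1` (all parameters) give `∫⁻ |…| dP_N ≤ 9 C_w L τ δ_N + 3 C_w |c₀θ| τ κ`;
let `N → ∞`, then `κ → 0`. No definitions.
References: H. Spohn, *Large Scale Dynamics of Interacting Particles* (1991), Part I §2.3, §3.3.
-/

noncomputable section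

namespace Summit.AtomisticToContinuum.HydrodynamicLimit.Theorems
namespace FluxClosureEq
namespace E5

open scoped BigOperators Topology Classical MeasureTheory ProbabilityTheory InnerProductSpace ENNReal
open Filter Set Function MeasureTheory
open Literature.MathematicalPhysics.KineticTheory Literature.Analysis.FluidPDE Literature.Analysis.FunctionSpaces
open Summit.AtomisticToContinuum.HydrodynamicLimit.Theses.BoxDissipativeWeakStrong
open Summit.AtomisticToContinuum.HydrodynamicLimit.Theorems.EntropyClockDock (ae_mem_good_localGibbsLaw)

/-! ### (C) Plumbing along one good orbit -/

/-- **Per-orbit bound.** Along a measurable configuration path `γ`, for a jointly measurable box kernel `k`, a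
jointly measurable pressure scalar `P(z, x)` bounded along the orbit, a test field `w` smooth on `[0,T) × 𝕋³` with
`|∂_jw_i| ≤ C` on `[0, τ]`, `τ < T`, and a POINTWISE bound
`|P(γ_t, x) − p∞| ≤ L (|ρ̂ − c₀| + ‖m̂ − m₀‖ + |Ê − E₀|) + K₀` (box fields of `γ_t` at `k(x, ·)`):
`ofReal |∫_0^τ∫ P div w − ∫_0^τ∫ p∞ div w| ≤ ∫⁻_(0,τ] (ofReal(3CL) (∫⁻|ρ̂ − c₀| + ∫⁻‖m̂ − m₀‖ + ∫⁻|Ê − E₀|) + ofReal(3CK₀))`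
(both functionals are integrable in `t` and in `x` — bounded measurable, `FluxClosureB4.integrableOn_Ioc_integral`,
`exists_measurable_fderiv` —, `‖∫f‖ₑ ≤ ∫⁻‖f‖ₑ` twice, `|div w| ≤ 3C`). [folklore] -/
theorem E5_orbit_bound {n : ℕ} {γ : ℝ → Config n (Fin 3) T3} (hγ : Measurable γ)
    {k : T3 → T3 → ℝ} (hk : Measurable fun p : T3 × T3 => k p.1 p.2)
    {P : Config n (Fin 3) T3 × T3 → ℝ} (hPm : Measurable P) {Pb : ℝ} (hPb : ∀ t x, |P (γ t, x)| ≤ Pb)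
    {T τ : ℝ} (hτ : τ ∈ Ico 0 T) {w : ℝ → T3 → V3} (hw : Torus.IsSmoothSpaceTimeOn (Ico 0 T) w) {C : ℝ}
    (hC0 : 0 ≤ C) (hC : ∀ t ∈ Icc 0 τ, ∀ (i j : Fin 3) (x : T3), |Torus.partialDeriv j (fun y => w t y i) x| ≤ C)
    {pinf c₀ E₀ L K₀ : ℝ} {m₀ : V3} (hL : 0 ≤ L) (hK₀ : 0 ≤ K₀)
    (hpt : ∀ t x, |P (γ t, x) - pinf| ≤ L * (|empiricalDensityField (γ t) (k x) - c₀| +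
        ‖empiricalMomentumField (γ t) (k x) - m₀‖ + |empiricalEnergyField (γ t) (k x) - E₀|) + K₀) :
    ENNReal.ofReal |(∫ t in Ioc 0 τ, ∫ x, P (γ t, x) * Torus.divergence (w t) x) -
        ∫ t in Ioc 0 τ, ∫ x, pinf * Torus.divergence (w t) x| ≤
      ∫⁻ t in Ioc 0 τ, (ENNReal.ofReal (3 * C * L) *
          ((∫⁻ x, ENNReal.ofReal |empiricalDensityField (γ t) (k x) - c₀|) +
            (∫⁻ x, ENNReal.ofReal ‖empiricalMomentumField (γ t) (k x) - m₀‖) +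
            ∫⁻ x, ENNReal.ofReal |empiricalEnergyField (γ t) (k x) - E₀|) +
        ENNReal.ofReal (3 * C * K₀)) := by
  have hτT : τ < T := hτ.2
  obtain ⟨H, C₁, hHm, -, hHs, -⟩ := FluxClosureB4.exists_measurable_fderiv hτT hw
  clear C₁
  obtain ⟨B, hB⟩ : ∃ B : Fin 3 → ℝ × T3 → ℝ, B = fun i p => H p (0, EuclideanSpace.single i 1) i := ⟨_, rfl⟩
  have mB : ∀ i, Measurable (B i) := fun i => by
    rw [hB]
    exact (show Measurable fun v : V3 => v i by fun_prop).comp (hHm.apply_continuousLinearMap _)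
  have mSB : Measurable fun p : ℝ × T3 => ∑ i, B i p := Finset.measurable_sum _ fun i _ => mB i
  have eDiv : ∀ t ∈ Ico 0 T, ∀ x, Torus.divergence (w t) x = ∑ i, B i (t, x) := fun t ht x => by
    simp only [Torus.divergence, hB, hHs t ht x]
  have bDiv : ∀ t ∈ Icc 0 τ, ∀ x, |Torus.divergence (w t) x| ≤ 3 * C := fun t ht x => by
    unfold Torus.divergence
    calc |∑ i, Torus.partialDeriv i (fun y => w t y i) x| ≤ ∑ i, |Torus.partialDeriv i (fun y => w t y i) x| :=
          Finset.abs_sum_le_sum_abs _ _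
      _ ≤ ∑ _i : Fin 3, C := Finset.sum_le_sum fun i _ => hC t ht i i x
      _ = 3 * C := by simp
  have bDivB : ∀ p : ℝ × T3, p.1 ∈ Icc 0 τ → |∑ i, B i p| ≤ 3 * C := fun p hp => by
    rw [← eDiv p.1 ⟨hp.1, hp.2.trans_lt hτT⟩ p.2]
    exact bDiv p.1 hp p.2
  have hPb0 : 0 ≤ Pb := (abs_nonneg _).trans (hPb 0 0)
  have mPγ : Measurable fun p : ℝ × T3 => P (γ p.1, p.2) := hPm.comp ((hγ.comp measurable_fst).prodMk measurable_snd)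
  -- (I1) integrability in `t` of both functionals
  have hI1 : IntegrableOn (fun t => ∫ x, P (γ t, x) * Torus.divergence (w t) x) (Ioc 0 τ) :=
    FluxClosureB4.integrableOn_Ioc_integral hτT (G := fun p => P (γ p.1, p.2) * ∑ i, B i p) (C := Pb * (3 * C))
      (mPγ.mul mSB) (fun t ht x => by simp only [eDiv t ht x]) fun p hp => by
        rw [abs_mul]
        exact mul_le_mul (hPb p.1 p.2) (bDivB p hp) (abs_nonneg _) hPb0
  have hI2 : IntegrableOn (fun t => ∫ x, pinf * Torus.divergence (w t) x) (Ioc 0 τ) :=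
    FluxClosureB4.integrableOn_Ioc_integral hτT (G := fun p => pinf * ∑ i, B i p) (C := |pinf| * (3 * C))
      (measurable_const.mul mSB) (fun t ht x => by simp only [eDiv t ht x]) fun p hp => by
        rw [abs_mul]
        exact mul_le_mul_of_nonneg_left (bDivB p hp) (abs_nonneg _)
  -- the chain
  rw [← integral_sub hI1 hI2, ← Real.enorm_eq_ofReal_abs]
  refine (enorm_integral_le_lintegral_enorm _).trans (setLIntegral_mono' measurableSet_Ioc fun t ht => ?_)
  have htT : t ∈ Ico 0 T := ⟨ht.1.le, ht.2.trans_lt hτT⟩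
  have htτ : t ∈ Icc 0 τ := ⟨ht.1.le, ht.2⟩
  have hdivm : Measurable fun x => Torus.divergence (w t) x := by
    have e : (fun x => Torus.divergence (w t) x) = fun x => ∑ i, B i (t, x) := funext (eDiv t htT)
    rw [e]
    exact mSB.comp (measurable_const.prodMk measurable_id)
  have mPx : Measurable fun x => P (γ t, x) := hPm.comp (measurable_const.prodMk measurable_id)
  have hIx : Integrable fun x => P (γ t, x) * Torus.divergence (w t) x :=
    (integrable_const (Pb * (3 * C))).mono' (mPx.mul hdivm).aestronglyMeasurable
      (ae_of_all _ fun x => by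
        rw [Real.norm_eq_abs, abs_mul]
        exact mul_le_mul (hPb t x) (bDiv t htτ x) (abs_nonneg _) hPb0)
  have hIxi : Integrable fun x => pinf * Torus.divergence (w t) x :=
    (integrable_const (|pinf| * (3 * C))).mono' (measurable_const.mul hdivm).aestronglyMeasurable
      (ae_of_all _ fun x => by
        rw [Real.norm_eq_abs, abs_mul]
        exact mul_le_mul_of_nonneg_left (bDiv t htτ x) (abs_nonneg _))
  rw [← integral_sub hIx hIxi]
  refine (enorm_integral_le_lintegral_enorm _).trans ?_
  have hcfg : Measurable fun x : T3 => ((γ t, x) : Config n (Fin 3) T3 × T3) := measurable_const.prodMk measurable_id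
  have m1 : Measurable fun x => ENNReal.ofReal |empiricalDensityField (γ t) (k x) - c₀| :=
    (((FluxClosureB5.measurable_density hk).comp hcfg).sub_const _).abs.ennreal_ofReal
  have m2 : Measurable fun x => ENNReal.ofReal ‖empiricalMomentumField (γ t) (k x) - m₀‖ :=
    (((FluxClosureB5.measurable_momentum hk).comp hcfg).sub_const _).norm.ennreal_ofReal
  have m3 : Measurable fun x => ENNReal.ofReal |empiricalEnergyField (γ t) (k x) - E₀| :=
    (((FluxClosureB5.measurable_energy hk).comp hcfg).sub_const _).abs.ennreal_ofReal
  calc ∫⁻ x, ‖P (γ t, x) * Torus.divergence (w t) x - pinf * Torus.divergence (w t) x‖ₑ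
      ≤ ∫⁻ x, (ENNReal.ofReal (3 * C * L) * (ENNReal.ofReal |empiricalDensityField (γ t) (k x) - c₀| +
          ENNReal.ofReal ‖empiricalMomentumField (γ t) (k x) - m₀‖ +
          ENNReal.ofReal |empiricalEnergyField (γ t) (k x) - E₀|) + ENNReal.ofReal (3 * C * K₀)) := by
        refine lintegral_mono fun x => ?_
        have key : |P (γ t, x) * Torus.divergence (w t) x - pinf * Torus.divergence (w t) x| ≤
            3 * C * L * (|empiricalDensityField (γ t) (k x) - c₀| + ‖empiricalMomentumField (γ t) (k x) - m₀‖ +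
              |empiricalEnergyField (γ t) (k x) - E₀|) + 3 * C * K₀ := by
          rw [← sub_mul, abs_mul]
          calc |P (γ t, x) - pinf| * |Torus.divergence (w t) x|
              ≤ (L * (|empiricalDensityField (γ t) (k x) - c₀| + ‖empiricalMomentumField (γ t) (k x) - m₀‖ +
                  |empiricalEnergyField (γ t) (k x) - E₀|) + K₀) * (3 * C) :=
                mul_le_mul (hpt t x) (bDiv t htτ x) (abs_nonneg _) (by positivity)
            _ = _ := by ring
        calc ‖P (γ t, x) * Torus.divergence (w t) x - pinf * Torus.divergence (w t) x‖ₑ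
            = ENNReal.ofReal |P (γ t, x) * Torus.divergence (w t) x - pinf * Torus.divergence (w t) x| :=
              Real.enorm_eq_ofReal_abs _
          _ ≤ _ := ENNReal.ofReal_le_ofReal key
          _ = _ := by
              rw [ENNReal.ofReal_add (by positivity) (by positivity), ENNReal.ofReal_mul (by positivity),
                ENNReal.ofReal_add (by positivity) (by positivity), ENNReal.ofReal_add (by positivity) (by positivity)]
    _ = _ := by
        have m12 : Measurable fun x => ENNReal.ofReal |empiricalDensityField (γ t) (k x) - c₀| +
            ENNReal.ofReal ‖empiricalMomentumField (γ t) (k x) - m₀‖ := m1.add m2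
        have m123 : Measurable fun x => ENNReal.ofReal |empiricalDensityField (γ t) (k x) - c₀| +
            ENNReal.ofReal ‖empiricalMomentumField (γ t) (k x) - m₀‖ +
            ENNReal.ofReal |empiricalEnergyField (γ t) (k x) - E₀| := m12.add m3
        rw [lintegral_add_right _ measurable_const, lintegral_const, measure_univ, mul_one,
          lintegral_const_mul _ m123, lintegral_add_left m12, lintegral_add_left m1]

/-! ### (D) The `L¹(P_N)` bound at fixed `N` -/

/-- **The `L¹(P_N)` estimate of the cut-pressure defect at fixed `N`** (crux vocabulary). For `0 < ℓ_N ≤ 1`, `σ ≥ 0`,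
`c₀ > 0`, `η₁ ≥ 0`, `|Z| ≤ Z_max` on `[0, η₁]`, `τ ∈ [0,T)`, `w` smooth on `[0,T) × 𝕋³` with `|∂_jw_i| ≤ C` on `[0,τ]`,
and a modulus `|Z(min(rσ³,η₁)) − Z(min(c₀σ³,η₁))| ≤ κ` for `|r − c₀| < ϑ`, there is `L ≥ 0` such that for EVERY `N`
and every common bound `d_N` of the three fine-scale deviations (uniformly in `t`):
`∫⁻ |∫_0^τ∫ p_cut div w − ∫_0^τ∫ p∞ div w| dP_N ≤ L τ d_N + 3 C |c₀θ| κ τ`. Proof: `P_N`-a.e. datum is good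
(`ae_mem_good_localGibbsLaw`); `E5_orbit_bound` along good orbits (speeds bounded by energy conservation,
`FluxClosureB4.norm_vel_flow_le`, so `|p_cut| ≤ ⅔ V² ℓ⁻³ Z_max`; pointwise lemma `E5_abs_cutPressure_sub_le`); Tonelli in
`(z, t)` (`E5_aemeasurable_lintegral_comp_flow_prod`); the hypotheses at each `t`; `P_N(univ) ≤ 1`
(`E5_localGibbsLaw_const_univ_le_one`). [folklore] -/
theorem E5_lintegral_defect_le : ∀ (σ a θ c₀ η₁ T : ℝ) (u : V3) (Φ : (N : ℕ) → HardSphereFlow (Torus.geometry (Fin 3)) (hsDiameter σ N) (N + 1)) (ℓ : ℕ → ℝ), (∀ N, 0 < ℓ N ∧ ℓ N ≤ 1) → 0 ≤ σ → 0 < c₀ → 0 ≤ η₁ → ∀ (Zmax : ℝ), (∀ η ∈ Icc 0 η₁, |hsCompressibility η| ≤ Zmax) → let K := fun (l : ℝ) (x y : T3) => indicator {y' : T3 | ∀ i, ‖y' i - x i‖ < l / 2} (fun _ => (l ^ 3)⁻¹) y; let Dn := fun N t z x => empiricalDensityField ((Φ N).flow t z) (K (ℓ N) x); let Mm := fun N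 t z x => empiricalMomentumField ((Φ N).flow t z) (K (ℓ N) x); let En := fun N t z x => empiricalEnergyField ((Φ N).flow t z) (K (ℓ N) x); let Th := fun (r : ℝ) (m : V3) (E : ℝ) => 2 / 3 * (E / r - ‖m‖ ^ 2 / (2 * r ^ 2)); let Zc := fun η : ℝ => hsCompressibility (min η η₁); let Pc := fun r ϑ : ℝ => r * ϑ * Zc (r * σ ^ 3); ∀ τ ∈ Ico 0 T, ∀ w : ℝ → T3 → V3, Torus.IsSmoothSpaceTimeOn (Ico 0 T) w → ∀ (C : ℝ), 0 ≤ C → (∀ t ∈ Icc 0 τ, ∀ (i j : Fin 3) (x : T3), |Torus.partialDeriv j (fun y => w t y i) x| ≤ C) → ∀ (κ ϑ : ℝ), 0 ≤ κ → 0 < ϑ → (∀ r : ℝ, |r - c₀| < ϑ → |Zc (r * σ ^ 3) - Zc (c₀ * σ ^ 3)| ≤ κ) → ∃ L : ℝ, 0 ≤ L ∧ ∀ (N : ℕ) (dN : ℝ≥0∞), (∀ t : ℝ, (∫⁻ z, (∫⁻ x, ENNReal.ofReal |Dn N t z x - c₀|) ∂(localGibbsLaw σ (fun _ => a) (fun _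 => u) (fun _ => θ) N (Φ N))) ≤ dN) → (∀ t : ℝ, (∫⁻ z, (∫⁻ x, ENNReal.ofReal ‖Mm N t z x - c₀ • u‖) ∂(localGibbsLaw σ (fun _ => a) (fun _ => u) (fun _ => θ) N (Φ N))) ≤ dN) → (∀ t : ℝ, (∫⁻ z, (∫⁻ x, ENNReal.ofReal |En N t z x - totalEnergyDensity c₀ u θ|) ∂(localGibbsLaw σ (fun _ => a) (fun _ => u) (fun _ => θ) N (Φ N))) ≤ dN) → ∫⁻ z, ENNReal.ofReal (|(∫ t in Ioc 0 τ, ∫ x, Pc (Dn N t z x) (Th (Dn N t z x) (Mm N t z x) (En N t z x)) * Torus.divergence (w t) x) - ∫ t in Ioc 0 τ, ∫ x, Pc c₀ (Th c₀ (c₀ • u) (totalEnergyDensity c₀ u θ)) * Torus.divergence (w t) x|) ∂(localGibbsLaw σ (fun _ => a) (fun _ => u) (fun _ => θ) N (Φ N)) ≤ ENNReal.ofReal (L * τ) * dN + ENNReal.ofReal (3 * C * |c₀ * θ| * κ * τ) := by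
  intro σ a θ c₀ η₁ T u Φ ℓ hℓ hσ hc₀ hη₁ Zmax hZ
  dsimp only
  intro τ hτ w hw C hC0 hC κ ϑ hκ hϑ hmod
  have hτ0 : 0 ≤ τ := hτ.1
  have hZ0 : 0 ≤ Zmax := (abs_nonneg _).trans (hZ 0 ⟨le_rfl, hη₁⟩)
  -- the pointwise constant and the pointwise bound
  set L₀ : ℝ := Zmax * ((2 + (1 + 2 * ‖u‖ + 2 * |4 * totalEnergyDensity c₀ u θ + 2 * c₀ * ‖u‖ ^ 2| / c₀) *
    (1 + ‖u‖) + ‖u‖ ^ 2 + 2 * |4 * totalEnergyDensity c₀ u θ + 2 * c₀ * ‖u‖ ^ 2| / c₀) + 2 * |c₀ * θ| / ϑ + |θ|)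
    with hL₀
  have hL₀0 : 0 ≤ L₀ := by positivity
  have hpt : ∀ (r E : ℝ) (m : V3), 0 ≤ r → ‖m‖ ^ 2 ≤ 2 * r * E →
      |r * (2 / 3 * (E / r - ‖m‖ ^ 2 / (2 * r ^ 2))) * hsCompressibility (min (r * σ ^ 3) η₁) -
          c₀ * (2 / 3 * (totalEnergyDensity c₀ u θ / c₀ - ‖c₀ • u‖ ^ 2 / (2 * c₀ ^ 2))) *
            hsCompressibility (min (c₀ * σ ^ 3) η₁)| ≤
        L₀ * (|r - c₀| + ‖m - c₀ • u‖ + |E - totalEnergyDensity c₀ u θ|) + |c₀ * θ| * κ :=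
    fun r E m hr hmE => E5_abs_cutPressure_sub_le (g := fun r => hsCompressibility (min (r * σ ^ 3) η₁))
      hc₀ hZ0 hκ hϑ (E5_abs_cutZ_le hσ hη₁ hZ) hmod hr hmE
  refine ⟨3 * (3 * C * L₀), by positivity, fun N dN hD hM hE => ?_⟩
  -- the law: mass at most one, carried by the good set
  have hmass : localGibbsLaw σ (fun _ => a) (fun _ => u) (fun _ => θ) N (Φ N) univ ≤ 1 :=
    E5_localGibbsLaw_const_univ_le_one σ a θ u N (Φ N)
  haveI : IsFiniteMeasure (localGibbsLaw σ (fun _ => a) (fun _ => u) (fun _ => θ) N (Φ N)) :=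
    ⟨hmass.trans_lt ENNReal.one_lt_top⟩
  have hgood : ∀ᵐ z ∂(localGibbsLaw σ (fun _ => a) (fun _ => u) (fun _ => θ) N (Φ N)), z ∈ (Φ N).good :=
    ae_mem_good_localGibbsLaw σ (fun _ => a) (fun _ => θ) (fun _ => u) N (Φ N)
  have hμ : localGibbsLaw σ (fun _ => a) (fun _ => u) (fun _ => θ) N (Φ N) (Φ N).goodᶜ = 0 := mem_ae_iff.1 hgood
  -- the cube kernel
  have hk := LGFS.measurable_boxK_uncurry (ℓ N)
  have hk0 : ∀ x y : T3, 0 ≤ indicator {y' : T3 | ∀ i, ‖y' i - x i‖ < ℓ N / 2} (fun _ => (ℓ N ^ 3)⁻¹) y :=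
    fun x y => LGFS.boxK_nonneg (hℓ N).1.le x y
  have hkb : ∀ x y : T3, indicator {y' : T3 | ∀ i, ‖y' i - x i‖ < ℓ N / 2} (fun _ => (ℓ N ^ 3)⁻¹) y ≤ (ℓ N ^ 3)⁻¹ :=
    fun x y => LGFS.boxK_le (hℓ N).1.le x y
  have mDq := FluxClosureB5.measurable_density (n := N + 1)
    (K := fun x y => indicator {y' : T3 | ∀ i, ‖y' i - x i‖ < ℓ N / 2} (fun _ => (ℓ N ^ 3)⁻¹) y) hk
  have mMq := FluxClosureB5.measurable_momentum (n := N + 1)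
    (K := fun x y => indicator {y' : T3 | ∀ i, ‖y' i - x i‖ < ℓ N / 2} (fun _ => (ℓ N ^ 3)⁻¹) y) hk
  have mEq := FluxClosureB5.measurable_energy (n := N + 1)
    (K := fun x y => indicator {y' : T3 | ∀ i, ‖y' i - x i‖ < ℓ N / 2} (fun _ => (ℓ N ^ 3)⁻¹) y) hk
  have mhs : Measurable hsCompressibility := measurable_const.add (measurable_id.mul (measurable_deriv _))
  have mP : Measurable (fun q : Config (N + 1) (Fin 3) T3 × T3 => empiricalDensityField q.1 (fun y => indicator {y' : T3 | ∀ i, ‖y' i - q.2 i‖ < ℓ N / 2} (fun _ => (ℓ N ^ 3)⁻¹) y) * (2 / 3 * (empiricalEnergyField q.1 (fun y => indicator {y' : T3 | ∀ i, ‖y' i - q.2 i‖ < ℓ N / 2} (fun _ => (ℓ N ^ 3)⁻¹) y) / empiricalDensityField q.1 (fun y => indicator {y' : T3 | ∀ i, ‖y' i - q.2 i‖ < ℓ N / 2} (fun _ => (ℓ N ^ 3)⁻¹) y) - ‖empiricalMomentumField q.1 (fun y => indicator {y' : T3 | ∀ i, ‖y' i - q.2 i‖ < ℓ N / 2} (fun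 _ => (ℓ N ^ 3)⁻¹) y)‖ ^ 2 / (2 * empiricalDensityField q.1 (fun y => indicator {y' : T3 | ∀ i, ‖y' i - q.2 i‖ < ℓ N / 2} (fun _ => (ℓ N ^ 3)⁻¹) y) ^ 2))) * hsCompressibility (min (empiricalDensityField q.1 (fun y => indicator {y' : T3 | ∀ i, ‖y' i - q.2 i‖ < ℓ N / 2} (fun _ => (ℓ N ^ 3)⁻¹) y) * σ ^ 3) η₁)) :=
    (mDq.mul (((mEq.div mDq).sub ((mMq.norm.pow_const 2).div ((mDq.pow_const 2).const_mul 2))).const_mul _)).mul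
      (mhs.comp ((mDq.mul_const _).min measurable_const))
  -- the three deviation functionals and the majorant `G`
  obtain ⟨g₁, hg₁⟩ : ∃ g₁ : Config (N + 1) (Fin 3) T3 → ℝ → ℝ≥0∞, g₁ = fun z t =>
      ∫⁻ x : T3, ENNReal.ofReal |empiricalDensityField ((Φ N).flow t z) (fun y => indicator {y' : T3 | ∀ i, ‖y' i - x i‖ < ℓ N / 2} (fun _ => (ℓ N ^ 3)⁻¹) y) - c₀| := ⟨_, rfl⟩
  obtain ⟨g₂, hg₂⟩ : ∃ g₂ : Config (N + 1) (Fin 3) T3 → ℝ → ℝ≥0∞, g₂ = fun z t =>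
      ∫⁻ x : T3, ENNReal.ofReal ‖empiricalMomentumField ((Φ N).flow t z) (fun y => indicator {y' : T3 | ∀ i, ‖y' i - x i‖ < ℓ N / 2} (fun _ => (ℓ N ^ 3)⁻¹) y) - c₀ • u‖ := ⟨_, rfl⟩
  obtain ⟨g₃, hg₃⟩ : ∃ g₃ : Config (N + 1) (Fin 3) T3 → ℝ → ℝ≥0∞, g₃ = fun z t =>
      ∫⁻ x : T3, ENNReal.ofReal |empiricalEnergyField ((Φ N).flow t z) (fun y => indicator {y' : T3 | ∀ i, ‖y' i - x i‖ < ℓ N / 2} (fun _ => (ℓ N ^ 3)⁻¹) y) - totalEnergyDensity c₀ u θ| := ⟨_, rfl⟩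
  obtain ⟨G, hG⟩ : ∃ G : Config (N + 1) (Fin 3) T3 → ℝ → ℝ≥0∞, G = fun z t =>
      ENNReal.ofReal (3 * C * L₀) * (g₁ z t + g₂ z t + g₃ z t) + ENNReal.ofReal (3 * C * (|c₀ * θ| * κ)) := ⟨_, rfl⟩
  have m1 := (mDq.sub_const c₀).abs.ennreal_ofReal
  have m2 := (mMq.sub_const (c₀ • u)).norm.ennreal_ofReal
  have m3 := (mEq.sub_const (totalEnergyDensity c₀ u θ)).abs.ennreal_ofReal
  -- step 1: the per-orbit bound on the good set
  have step1 : ∀ᵐ z ∂(localGibbsLaw σ (fun _ => a) (fun _ => u) (fun _ => θ) N (Φ N)),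
      ENNReal.ofReal |(∫ t in Ioc 0 τ, ∫ x, (fun q : Config (N + 1) (Fin 3) T3 × T3 => empiricalDensityField q.1 (fun y => indicator {y' : T3 | ∀ i, ‖y' i - q.2 i‖ < ℓ N / 2} (fun _ => (ℓ N ^ 3)⁻¹) y) * (2 / 3 * (empiricalEnergyField q.1 (fun y => indicator {y' : T3 | ∀ i, ‖y' i - q.2 i‖ < ℓ N / 2} (fun _ => (ℓ N ^ 3)⁻¹) y) / empiricalDensityField q.1 (fun y => indicator {y' : T3 | ∀ i, ‖y' i - q.2 i‖ < ℓ N / 2} (fun _ => (ℓ N ^ 3)⁻¹) y) - ‖empiricalMomentumField q.1 (fun y => indicator {y' : T3 | ∀ i, ‖y' i - q.2 i‖ < ℓ N / 2} (fun _ => (ℓ N ^ 3)⁻¹) y)‖ ^ 2 / (2 * empiricalDensityField q.1 (fun y => indicator {y' : T3 | ∀ i, ‖y' i - q.2 i‖ < ℓ N / 2} (fun _ => (ℓ N ^ 3)⁻¹) y) ^ 2))) * hsCompressibility (min (empiricalDensityField q.1 (fun y => indicator {y' : T3 | ∀ i, ‖y' i - q.2 i‖ < ℓ N / 2} (fun _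 => (ℓ N ^ 3)⁻¹) y) * σ ^ 3) η₁)) ((Φ N).flow t z, x) * Torus.divergence (w t) x) -
        ∫ t in Ioc 0 τ, ∫ x, c₀ * (2 / 3 * (totalEnergyDensity c₀ u θ / c₀ - ‖c₀ • u‖ ^ 2 / (2 * c₀ ^ 2))) *
          hsCompressibility (min (c₀ * σ ^ 3) η₁) * Torus.divergence (w t) x| ≤ ∫⁻ t in Ioc 0 τ, G z t := by
    filter_upwards [hgood] with z hz
    have hγ : Measurable fun t : ℝ => (Φ N).flow t z :=
      (Φ N).measurable_flow_prod_torus.comp ((measurable_const (a := (⟨z, hz⟩ : (Φ N).good))).prodMk measurable_id)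
    have hVb := fun t i => FluxClosureB4.norm_vel_flow_le (Φ N) hz t i
    have hℓ0 : 0 < ℓ N := (hℓ N).1
    have hPb : ∀ t x, |(fun q : Config (N + 1) (Fin 3) T3 × T3 => empiricalDensityField q.1 (fun y => indicator {y' : T3 | ∀ i, ‖y' i - q.2 i‖ < ℓ N / 2} (fun _ => (ℓ N ^ 3)⁻¹) y) * (2 / 3 * (empiricalEnergyField q.1 (fun y => indicator {y' : T3 | ∀ i, ‖y' i - q.2 i‖ < ℓ N / 2} (fun _ => (ℓ N ^ 3)⁻¹) y) / empiricalDensityField q.1 (fun y => indicator {y' : T3 | ∀ i, ‖y' i - q.2 i‖ < ℓ N / 2} (fun _ => (ℓ N ^ 3)⁻¹) y) - ‖empiricalMomentumField q.1 (fun y => indicator {y' : T3 | ∀ i, ‖y' i - q.2 i‖ < ℓ N / 2} (fun _ => (ℓ N ^ 3)⁻¹) y)‖ ^ 2 / (2 * empiricalDensityField q.1 (fun y => indicator {y' : T3 | ∀ i, ‖y' i - q.2 i‖ < ℓ N / 2} (fun _ => (ℓ N ^ 3)⁻¹) y) ^ 2))) * hsCompressibility (min (empiricalDensityField q.1 (fun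 y => indicator {y' : T3 | ∀ i, ‖y' i - q.2 i‖ < ℓ N / 2} (fun _ => (ℓ N ^ 3)⁻¹) y) * σ ^ 3) η₁)) ((Φ N).flow t z, x)| ≤
        2 / 3 * (Real.sqrt (∑ j, ‖(z j).2‖ ^ 2) ^ 2 * (ℓ N ^ 3)⁻¹) * Zmax := fun t x => by
      obtain ⟨⟨hD0, hDk⟩, -, -, hEb⟩ := FluxClosureB4.boxAtoms_bounds ((Φ N).flow t z) (hk0 x) (hkb x) (hVb t)
      obtain ⟨-, -, -, h2⟩ := E5_box_facts ((Φ N).flow t z) x (hk0 x)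
      dsimp only
      rw [abs_mul]
      refine mul_le_mul (h2.trans ?_) (E5_abs_cutZ_le hσ hη₁ hZ _ hD0) (abs_nonneg _) (by positivity)
      exact mul_le_mul_of_nonneg_left (hEb.trans (mul_le_mul_of_nonneg_left hDk (sq_nonneg _))) (by norm_num)
    rw [hG, hg₁, hg₂, hg₃]
    exact E5_orbit_bound (m₀ := c₀ • u) (E₀ := totalEnergyDensity c₀ u θ) hγ hk mP hPb hτ hw hC0 hC hL₀0
      (by positivity : 0 ≤ |c₀ * θ| * κ)
      fun t x => hpt _ _ _ (E5_box_facts ((Φ N).flow t z) x (hk0 x)).1 (E5_box_facts ((Φ N).flow t z) x (hk0 x)).2.2.1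
  -- step 2: Tonelli in `(z, t)`
  have hGm : AEMeasurable (uncurry G)
      ((localGibbsLaw σ (fun _ => a) (fun _ => u) (fun _ => θ) N (Φ N)).prod (volume.restrict (Ioc 0 τ))) := by
    rw [hG, hg₁, hg₂, hg₃]
    exact ((((E5_aemeasurable_lintegral_comp_flow_prod (Φ N) m1 hμ _).add
      (E5_aemeasurable_lintegral_comp_flow_prod (Φ N) m2 hμ _)).add
      (E5_aemeasurable_lintegral_comp_flow_prod (Φ N) m3 hμ _)).const_mul _).add_const _
  -- step 3: the hypotheses at each frozen time
  have step3 : ∀ t, ∫⁻ z, G z t ∂(localGibbsLaw σ (fun _ => a) (fun _ => u) (fun _ => θ) N (Φ N)) ≤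
      ENNReal.ofReal (3 * C * L₀) * (dN + dN + dN) + ENNReal.ofReal (3 * C * (|c₀ * θ| * κ)) := by
    intro t
    have n1 : Measurable fun z => g₁ z t := by rw [hg₁]; exact E5_measurable_lintegral_comp_flow (Φ N) m1 t
    have n2 : Measurable fun z => g₂ z t := by rw [hg₂]; exact E5_measurable_lintegral_comp_flow (Φ N) m2 t
    have n3 : Measurable fun z => g₃ z t := by rw [hg₃]; exact E5_measurable_lintegral_comp_flow (Φ N) m3 t
    have n12 : Measurable fun z => g₁ z t + g₂ z t := n1.add n2
    have n123 : Measurable fun z => g₁ z t + g₂ z t + g₃ z t := n12.add n3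
    have h1 : ∫⁻ z, g₁ z t ∂(localGibbsLaw σ (fun _ => a) (fun _ => u) (fun _ => θ) N (Φ N)) ≤ dN := by
      rw [hg₁]; exact hD t
    have h2 : ∫⁻ z, g₂ z t ∂(localGibbsLaw σ (fun _ => a) (fun _ => u) (fun _ => θ) N (Φ N)) ≤ dN := by
      rw [hg₂]; exact hM t
    have h3 : ∫⁻ z, g₃ z t ∂(localGibbsLaw σ (fun _ => a) (fun _ => u) (fun _ => θ) N (Φ N)) ≤ dN := by
      rw [hg₃]; exact hE t
    rw [hG]
    dsimp only
    rw [lintegral_add_right _ measurable_const, lintegral_const_mul _ n123, lintegral_add_left n12,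
      lintegral_add_left n1, lintegral_const]
    calc ENNReal.ofReal (3 * C * L₀) * ((∫⁻ z, g₁ z t ∂(localGibbsLaw σ (fun _ => a) (fun _ => u) (fun _ => θ) N (Φ N))) +
          (∫⁻ z, g₂ z t ∂(localGibbsLaw σ (fun _ => a) (fun _ => u) (fun _ => θ) N (Φ N))) +
          ∫⁻ z, g₃ z t ∂(localGibbsLaw σ (fun _ => a) (fun _ => u) (fun _ => θ) N (Φ N))) +
          ENNReal.ofReal (3 * C * (|c₀ * θ| * κ)) * localGibbsLaw σ (fun _ => a) (fun _ => u) (fun _ => θ) N (Φ N) univ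
        ≤ ENNReal.ofReal (3 * C * L₀) * (dN + dN + dN) + ENNReal.ofReal (3 * C * (|c₀ * θ| * κ)) * 1 := by
          gcongr
      _ = _ := by rw [mul_one]
  -- assembly
  have e3 : ENNReal.ofReal 3 = 3 := by norm_num
  calc ∫⁻ z, ENNReal.ofReal |(∫ t in Ioc 0 τ, ∫ x, (fun q : Config (N + 1) (Fin 3) T3 × T3 => empiricalDensityField q.1 (fun y => indicator {y' : T3 | ∀ i, ‖y' i - q.2 i‖ < ℓ N / 2} (fun _ => (ℓ N ^ 3)⁻¹) y) * (2 / 3 * (empiricalEnergyField q.1 (fun y => indicator {y' : T3 | ∀ i, ‖y' i - q.2 i‖ < ℓ N / 2} (fun _ => (ℓ N ^ 3)⁻¹) y) / empiricalDensityField q.1 (fun y => indicator {y' : T3 | ∀ i, ‖y' i - q.2 i‖ < ℓ N / 2} (fun _ => (ℓ N ^ 3)⁻¹) y) - ‖empiricalMomentumField q.1 (fun y => indicator {y' : T3 | ∀ i, ‖y' i - q.2 i‖ < ℓ N / 2} (fun _ => (ℓ N ^ 3)⁻¹) y)‖ ^ 2 / (2 * empiricalDensityField q.1 (fun y => indicator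 {y' : T3 | ∀ i, ‖y' i - q.2 i‖ < ℓ N / 2} (fun _ => (ℓ N ^ 3)⁻¹) y) ^ 2))) * hsCompressibility (min (empiricalDensityField q.1 (fun y => indicator {y' : T3 | ∀ i, ‖y' i - q.2 i‖ < ℓ N / 2} (fun _ => (ℓ N ^ 3)⁻¹) y) * σ ^ 3) η₁)) ((Φ N).flow t z, x) * Torus.divergence (w t) x) -
        ∫ t in Ioc 0 τ, ∫ x, c₀ * (2 / 3 * (totalEnergyDensity c₀ u θ / c₀ - ‖c₀ • u‖ ^ 2 / (2 * c₀ ^ 2))) *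
          hsCompressibility (min (c₀ * σ ^ 3) η₁) * Torus.divergence (w t) x|
        ∂(localGibbsLaw σ (fun _ => a) (fun _ => u) (fun _ => θ) N (Φ N))
      ≤ ∫⁻ z, (∫⁻ t in Ioc 0 τ, G z t) ∂(localGibbsLaw σ (fun _ => a) (fun _ => u) (fun _ => θ) N (Φ N)) :=
        lintegral_mono_ae step1
    _ = ∫⁻ t in Ioc 0 τ, ∫⁻ z, G z t ∂(localGibbsLaw σ (fun _ => a) (fun _ => u) (fun _ => θ) N (Φ N)) :=
        lintegral_lintegral_swap hGm
    _ ≤ ∫⁻ _t in Ioc 0 τ, (ENNReal.ofReal (3 * C * L₀) * (dN + dN + dN) + ENNReal.ofReal (3 * C * (|c₀ * θ| * κ))) :=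
        lintegral_mono fun t => step3 t
    _ = (ENNReal.ofReal (3 * C * L₀) * (dN + dN + dN) + ENNReal.ofReal (3 * C * (|c₀ * θ| * κ))) * ENNReal.ofReal τ := by
        rw [setLIntegral_const, Real.volume_Ioc, sub_zero]
    _ = ENNReal.ofReal (3 * (3 * C * L₀) * τ) * dN + ENNReal.ofReal (3 * C * |c₀ * θ| * κ * τ) := by
        rw [add_mul, ENNReal.ofReal_mul (by positivity : (0 : ℝ) ≤ 3 * (3 * C * L₀)),
          ENNReal.ofReal_mul (by norm_num : (0 : ℝ) ≤ 3), e3,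
          show (3 : ℝ) * C * |c₀ * θ| * κ * τ = 3 * C * (|c₀ * θ| * κ) * τ by ring,
          ENNReal.ofReal_mul (by positivity : (0 : ℝ) ≤ 3 * C * (|c₀ * θ| * κ))]
        ring

/-! ### (E) The registered stub -/

/-- **Rung-0 piece E5 of crux `FluxClosure` (registered stub `homogeneous_pressureTerm`).** In global equilibrium
(constant profiles, law `P_N = localGibbsLaw σ a u θ N (Φ N)`), GIVEN the uniform-in-time fine-scale bounds
`∫⁻∫⁻|ρ̂ − c₀| ≤ δ_N`, `∫⁻∫⁻‖m̂ − c₀u‖ ≤ δ_N`, `∫⁻∫⁻|Ê − E(c₀,u,θ)| ≤ δ_N` with `δ_N → 0`, and `σ ≥ 0`, `c₀ > 0`,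
`η₁ ≥ 0`, `Z` continuous on `[0, η₁]`: for every `τ ∈ [0,T)` and every `w` smooth on `[0,T) × 𝕋³`, the cut-pressure
term `∫_0^τ∫ p_cut(ρ̂, θ̂) div w` converges in `L¹(P_N)` to `∫_0^τ∫ p_cut(c₀, θ) div w`. Proof: `|Z| ≤ Z_max` on
`[0, η₁]` (compactness), `C = sup |∂_jw_i|` on `[0,τ] × 𝕋³` (`FluxClosureK.exists_forall_abs_partialDeriv_le_slab`); for
`ε > 0` pick `κ > 0` with `3C|c₀θ|κτ < ε`, a modulus `ϑ` (`E5_cutZ_modulus`), and the constant `L` of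
`E5_lintegral_defect_le`; then `∫⁻ |…| dP_N ≤ Lτ δ_N + 3C|c₀θ|κτ → 3C|c₀θ|κτ < ε`. [folklore] -/
theorem homogeneous_pressureTerm : ∀ (σ a θ c₀ η₁ T : ℝ) (u : V3) (Φ : (N : ℕ) → HardSphereFlow (Torus.geometry (Fin 3)) (hsDiameter σ N) (N + 1)) (ℓ : ℕ → ℝ), (∀ N, 0 < ℓ N ∧ ℓ N ≤ 1) → 0 ≤ σ → 0 < c₀ → 0 ≤ η₁ → ContinuousOn hsCompressibility (Icc 0 η₁) → let K := fun (l : ℝ) (x y : T3) => indicator {y' : T3 | ∀ i, ‖y' i - x i‖ < l / 2} (fun _ => (l ^ 3)⁻¹) y; let Dn := fun N t z x => empiricalDensityField ((Φ N).flow t z) (K (ℓ N) x); let Mm := fun N t z x => empiricalMomentumField ((Φ N).flow t z) (K (ℓ N) x); let En := fun N t z x => empiricalEnergyField ((Φ N).flow t z) (K (ℓ N) x); let Th := fun (r : ℝ) (m : V3) (E : ℝ) => 2 / 3 * (E / r - ‖m‖ ^ 2 / (2 * r ^ 2)); let Zc := fun η : ℝ => hsCompressibility (min η η₁); let Pc :=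 fun r ϑ : ℝ => r * ϑ * Zc (r * σ ^ 3); ∀ δ : ℕ → ℝ≥0∞, Tendsto δ atTop (𝓝 0) → (∀ (N : ℕ) (t : ℝ), (∫⁻ z, (∫⁻ x, ENNReal.ofReal |Dn N t z x - c₀|) ∂(localGibbsLaw σ (fun _ => a) (fun _ => u) (fun _ => θ) N (Φ N)) ≤ δ N) ∧ (∫⁻ z, (∫⁻ x, ENNReal.ofReal ‖Mm N t z x - c₀ • u‖) ∂(localGibbsLaw σ (fun _ => a) (fun _ => u) (fun _ => θ) N (Φ N)) ≤ δ N) ∧ (∫⁻ z, (∫⁻ x, ENNReal.ofReal |En N t z x - totalEnergyDensity c₀ u θ|) ∂(localGibbsLaw σ (fun _ => a) (fun _ => u) (fun _ => θ) N (Φ N)) ≤ δ N)) → ∀ τ ∈ Ico 0 T, ∀ w : ℝ → T3 → V3, Torus.IsSmoothSpaceTimeOn (Ico 0 T) w → Tendsto (fun N : ℕ => ∫⁻ z, ENNReal.ofReal (|(∫ t in Ioc 0 τ, ∫ x, Pc (Dn N t z x) (Th (Dn N t z x) (Mm N t z x) (En N t z x)) * Torus.divergence (w t) x) - ∫ t in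 Ioc 0 τ, ∫ x, Pc c₀ (Th c₀ (c₀ • u) (totalEnergyDensity c₀ u θ)) * Torus.divergence (w t) x|) ∂(localGibbsLaw σ (fun _ => a) (fun _ => u) (fun _ => θ) N (Φ N))) atTop (𝓝 0) := by
  intro σ a θ c₀ η₁ T u Φ ℓ hℓ hσ hc₀ hη₁ hZc
  obtain ⟨Zmax, hZmax⟩ : ∃ Zmax : ℝ, ∀ η ∈ Icc 0 η₁, |hsCompressibility η| ≤ Zmax := by
    obtain ⟨Cz, hCz⟩ := isCompact_Icc.exists_bound_of_continuousOn hZc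
    exact ⟨Cz, fun η hη => (Real.norm_eq_abs _).symm.trans_le (hCz η hη)⟩
  have hDef := E5_lintegral_defect_le σ a θ c₀ η₁ T u Φ ℓ hℓ hσ hc₀ hη₁ Zmax hZmax
  dsimp only at hDef ⊢
  intro δ hδ hyp τ hτ w hw
  obtain ⟨C, hC0, hC⟩ := FluxClosureK.exists_forall_abs_partialDeriv_le_slab hτ.2 hw
  have hτ0 : 0 ≤ τ := hτ.1
  rw [ENNReal.tendsto_nhds_zero]
  intro ε hε
  -- choose `κ` with `3 C |c₀θ| κ τ < ε`
  obtain ⟨κ, hκ, hκε⟩ : ∃ κ : ℝ, 0 < κ ∧ ENNReal.ofReal (3 * C * |c₀ * θ| * κ * τ) < ε := by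
    rcases eq_or_ne ε ⊤ with h | h
    · exact ⟨1, one_pos, h ▸ ENNReal.ofReal_lt_top⟩
    · have hε' : 0 < ε.toReal := ENNReal.toReal_pos hε.ne' h
      refine ⟨ε.toReal / 2 / (3 * C * |c₀ * θ| * τ + 1), by positivity, ?_⟩
      have hK : 0 ≤ 3 * C * |c₀ * θ| * τ := by positivity
      have hq : 3 * C * |c₀ * θ| * τ / (3 * C * |c₀ * θ| * τ + 1) ≤ 1 := by
        rw [div_le_one (by positivity)]; linarith
      have key : 3 * C * |c₀ * θ| * (ε.toReal / 2 / (3 * C * |c₀ * θ| * τ + 1)) * τ < ε.toReal :=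
        calc 3 * C * |c₀ * θ| * (ε.toReal / 2 / (3 * C * |c₀ * θ| * τ + 1)) * τ
            = 3 * C * |c₀ * θ| * τ / (3 * C * |c₀ * θ| * τ + 1) * (ε.toReal / 2) := by
              field_simp
          _ ≤ 1 * (ε.toReal / 2) := by gcongr
          _ < ε.toReal := by linarith
      calc ENNReal.ofReal (3 * C * |c₀ * θ| * (ε.toReal / 2 / (3 * C * |c₀ * θ| * τ + 1)) * τ)
          < ENNReal.ofReal ε.toReal := (ENNReal.ofReal_lt_ofReal_iff hε').2 key
        _ = ε := ENNReal.ofReal_toReal h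
  obtain ⟨ϑ, hϑ, hmod⟩ := E5_cutZ_modulus (σ := σ) hσ hη₁ hc₀ hZc hκ
  obtain ⟨L, hL0, hL⟩ := hDef τ hτ w hw C hC0 hC κ ϑ hκ.le hϑ hmod
  -- the right-hand side tends to `3 C |c₀θ| κ τ < ε`
  have hlim : Tendsto (fun N => ENNReal.ofReal (L * τ) * δ N + ENNReal.ofReal (3 * C * |c₀ * θ| * κ * τ)) atTop
      (𝓝 (ENNReal.ofReal (L * τ) * 0 + ENNReal.ofReal (3 * C * |c₀ * θ| * κ * τ))) :=
    (ENNReal.Tendsto.const_mul hδ (Or.inr ENNReal.ofReal_ne_top)).add tendsto_const_nhds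
  rw [mul_zero, zero_add] at hlim
  filter_upwards [(tendsto_order.1 hlim).2 ε hκε] with N hN
  exact (hL N (δ N) (fun t => (hyp N t).1) (fun t => (hyp N t).2.1) (fun t => (hyp N t).2.2)).trans hN.le

end E5
end FluxClosureEq
end Summit.AtomisticToContinuum.HydrodynamicLimit.Theorems
end
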